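import Summits.QuantumFields.GaugeBoot.SOMasterLoopDerivatives
import HarnessLib

/-!
# Continuity and the cylinder property of the insertion products (gauge-boot, ADDENDUM 27 part M3b)

HONEST FRAMING (cell `pub-gaugeboot`, page 1 of every file): the venture produces certified bounds
on lattice expectations at stated coupling, gauge group, dimension and torus size; NOT a mass gap,
NOT a continuum limit, NOT a string tension; NOT Yang–Mills-summit-bearing (barriers
`FixedCouplingUltralocality`, `PerturbativeInvisibility`).  Regularity bookkeeping only.

## Content

Sequel of `SOMasterLoopDerivatives` (programme on the tree's NAMED FACT
`Chatterjee2019LargeN.UnsymmetrizedMasterLoopEquation`, Chatterjee CMP 366 (2019) Thm 8.1): the products of letter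
matrices, the insertion products `insProd` and the double-insertion products `ins2Prod` are CONTINUOUS functions of the
configuration (`continuous_prod_letterMat`, `continuous_insProd`, `continuous_ins2Prod`) and CYLINDER functions on the
edge support of the word (`support`, `dependsOn_prod_letterMat`, `dependsOn_insProd`, `dependsOn_ins2Prod`) — the
hypotheses of the one-link Schwinger–Dyson identity `IsHaarShiftStateAt.integral_shiftDeriv_eq_complex` (part M0).
Everything is `[folklore]`.
-/

noncomputable section

open NormedSpace
open scoped Matrix.Norms.Frobenius Matrix
open Literature.MathematicalPhysics.QuantumLattice (LGConfig ZdEdge)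
open Literature.MathematicalPhysics.QuantumFieldTheory (Chatterjee2019LargeN.Word)
open Literature.MathematicalPhysics.QuantumFieldTheory.Chatterjee2019LargeN
  (SO soRep DEdge isSpecialOrthogonalModel_soRep)

namespace Summit.QuantumFields.GaugeBoot

namespace SOMasterLoop

variable {d N : ℕ}

/-! ## Continuity and the cylinder property -/

section Regularity

variable (ε : ZdEdge d) (X : Matrix (Fin N) (Fin N) ℂ)

/-- Letter matrices are continuous in the configuration. [folklore] -/
theorem continuous_letterMat (a : DEdge d) : Continuous fun U : LGConfig d (SO N) => letterMat U a := by
  unfold letterMat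
  cases a.2
  · exact (isSpecialOrthogonalModel_soRep N).1.comp ((continuous_apply a.1).inv)
  · exact (isSpecialOrthogonalModel_soRep N).1.comp (continuous_apply a.1)

/-- Insertion matrices are continuous in the configuration. [folklore] -/
theorem continuous_insMat (a : DEdge d) : Continuous fun U : LGConfig d (SO N) => insMat ε X U a := by
  unfold insMat
  split_ifs
  · exact continuous_const.mul (continuous_letterMat a)
  · exact ((continuous_letterMat a).mul continuous_const).neg
  · exact continuous_const

/-- Double-insertion matrices are continuous in the configuration. [folklore] -/
theorem continuous_ins2Mat (a : DEdge d) : Continuous fun U : LGConfig d (SO N) => ins2Mat ε X U a := by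
  unfold ins2Mat
  split_ifs
  · exact continuous_const.mul (continuous_letterMat a)
  · exact ((continuous_letterMat a).mul continuous_const).mul continuous_const
  · exact continuous_const

/-- A product of a list of continuous matrix-valued functions is continuous (pointwise list form). [folklore] -/
theorem continuous_prod_of_forall {ι : Type*} [TopologicalSpace ι] :
    ∀ (Fs : List (ι → Matrix (Fin N) (Fin N) ℂ)), (∀ F ∈ Fs, Continuous F) →
      Continuous fun U => (Fs.map fun F => F U).prod
  | [], _ => by simpa using continuous_const
  | F :: Fs, h => by
    simp only [List.map_cons, List.prod_cons]
    exact (h F (by simp)).mul (continuous_prod_of_forall Fs fun G hG => h G (by simp [hG]))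

/-- The letter-function list of a word, with replacements: position `x ↦ insMat`-function. [folklore] -/
theorem insProd_eq_map (l : Chatterjee2019LargeN.Word d) (x : Fin l.length) (U : LGConfig d (SO N)) :
    insProd ε X l x U = (((l.map fun a => fun V : LGConfig d (SO N) => letterMat V a).set x
      (fun V => insMat ε X V (l.get x))).map fun F => F U).prod := by
  rw [insProd, map_set_eq, List.map_map]
  rfl

/-- The same for the double insertion. [folklore] -/
theorem ins2Prod_eq_map (l : Chatterjee2019LargeN.Word d) (x y : Fin l.length) (U : LGConfig d (SO N)) :
    ins2Prod ε X l x y U = ((((l.map fun a => fun V : LGConfig d (SO N) => letterMat V a).set x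
      (fun V => insMat ε X V (l.get x))).set y
      (fun V => if y = x then ins2Mat ε X V (l.get x) else insMat ε X V (l.get y))).map
        fun F => F U).prod := by
  rw [ins2Prod, map_set_eq, map_set_eq, List.map_map]
  split_ifs <;> rfl

/-- Membership in a `set` list. [folklore] -/
theorem mem_set_cases {α : Type*} {l : List α} {n : ℕ} {a b : α} (h : b ∈ l.set n a) : b ∈ l ∨ b = a := by
  induction l generalizing n with
  | nil => simp at h
  | cons c l ih =>
    cases n with
    | zero =>
      simp only [List.set_cons_zero, List.mem_cons] at h
      rcases h with rfl | h
      · exact Or.inr rfl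
      · exact Or.inl (List.mem_cons_of_mem _ h)
    | succ n =>
      simp only [List.set_cons_succ, List.mem_cons] at h
      rcases h with rfl | h
      · exact Or.inl (List.mem_cons_self)
      · rcases ih h with h | h
        · exact Or.inl (List.mem_cons_of_mem _ h)
        · exact Or.inr h

/-- **Insertion products are continuous in the configuration.** [folklore] -/
theorem continuous_insProd (l : Chatterjee2019LargeN.Word d) (x : Fin l.length) :
    Continuous fun U : LGConfig d (SO N) => insProd ε X l x U := by
  have h : (fun U : LGConfig d (SO N) => insProd ε X l x U) = fun U =>
      (((l.map fun a => fun V : LGConfig d (SO N) => letterMat V a).set x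
        (fun V => insMat ε X V (l.get x))).map fun F => F U).prod := funext (insProd_eq_map ε X l x)
  rw [h]
  refine continuous_prod_of_forall _ fun F hF => ?_
  rcases mem_set_cases hF with hF | rfl
  · obtain ⟨a, -, rfl⟩ := List.mem_map.1 hF
    exact continuous_letterMat a
  · exact continuous_insMat ε X _

/-- **Double-insertion products are continuous in the configuration.** [folklore] -/
theorem continuous_ins2Prod (l : Chatterjee2019LargeN.Word d) (x y : Fin l.length) :
    Continuous fun U : LGConfig d (SO N) => ins2Prod ε X l x y U := by
  have h : (fun U : LGConfig d (SO N) => ins2Prod ε X l x y U) = fun U =>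
      ((((l.map fun a => fun V : LGConfig d (SO N) => letterMat V a).set x
        (fun V => insMat ε X V (l.get x))).set y
        (fun V => if y = x then ins2Mat ε X V (l.get x) else insMat ε X V (l.get y))).map
          fun F => F U).prod := funext (ins2Prod_eq_map ε X l x y)
  rw [h]
  refine continuous_prod_of_forall _ fun F hF => ?_
  rcases mem_set_cases hF with hF | rfl
  · rcases mem_set_cases hF with hF | rfl
    · obtain ⟨a, -, rfl⟩ := List.mem_map.1 hF
      exact continuous_letterMat a
    · exact continuous_insMat ε X _
  · split_ifs
    · exact continuous_ins2Mat ε X _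
    · exact continuous_insMat ε X _

/-- **Products of letters are continuous** (the Wilson loop variable in `ℂ`). [folklore] -/
theorem continuous_prod_letterMat (l : Chatterjee2019LargeN.Word d) :
    Continuous fun U : LGConfig d (SO N) => (l.map (letterMat U)).prod := by
  have h : (fun U : LGConfig d (SO N) => (l.map (letterMat U)).prod) = fun U =>
      ((l.map fun a => fun V : LGConfig d (SO N) => letterMat V a).map fun F => F U).prod := by
    funext U; rw [List.map_map]; rfl
  rw [h]
  refine continuous_prod_of_forall _ fun F hF => ?_
  obtain ⟨a, -, rfl⟩ := List.mem_map.1 hF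
  exact continuous_letterMat a

/-- The edge support of a word: its undirected edges. [folklore] -/
def support (l : Chatterjee2019LargeN.Word d) : Finset (ZdEdge d) := (l.map Prod.fst).toFinset

/-- Letter matrices depend only on the letter's edge. [folklore] -/
theorem letterMat_congr {U V : LGConfig d (SO N)} {a : DEdge d} (h : U a.1 = V a.1) : letterMat U a = letterMat V a := by
  unfold letterMat; rw [h]

/-- Insertion matrices depend only on the letter's edge. [folklore] -/
theorem insMat_congr {U V : LGConfig d (SO N)} {a : DEdge d} (h : U a.1 = V a.1) :
    insMat ε X U a = insMat ε X V a := by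
  unfold insMat; rw [letterMat_congr h]

/-- Double-insertion matrices depend only on the letter's edge. [folklore] -/
theorem ins2Mat_congr {U V : LGConfig d (SO N)} {a : DEdge d} (h : U a.1 = V a.1) :
    ins2Mat ε X U a = ins2Mat ε X V a := by
  unfold ins2Mat; rw [letterMat_congr h]

/-- The edge of a letter of `l` lies in the support. [folklore] -/
theorem fst_get_mem_support (l : Chatterjee2019LargeN.Word d) (x : Fin l.length) : (l.get x).1 ∈ support l := by
  simp only [support, List.mem_toFinset, List.mem_map]
  exact ⟨l.get x, List.get_mem l x, rfl⟩

/-- **Products of letters are cylinder functions** on the support of the word. [folklore] -/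
theorem dependsOn_prod_letterMat (l : Chatterjee2019LargeN.Word d) :
    DependsOn (fun U : LGConfig d (SO N) => (l.map (letterMat U)).prod) (↑(support l) : Set (ZdEdge d)) := by
  intro U V h
  change (l.map (letterMat U)).prod = (l.map (letterMat V)).prod
  congr 1
  refine List.map_congr_left fun a ha => letterMat_congr (h a.1 ?_)
  simp only [support, List.coe_toFinset, Set.mem_setOf_eq, List.mem_map]
  exact ⟨a, ha, rfl⟩

/-- **Insertion products are cylinder functions** on the support of the word. [folklore] -/
theorem dependsOn_insProd (l : Chatterjee2019LargeN.Word d) (x : Fin l.length) :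
    DependsOn (fun U : LGConfig d (SO N) => insProd ε X l x U) (↑(support l) : Set (ZdEdge d)) := by
  intro U V h
  have hl : l.map (letterMat U) = l.map (letterMat V) :=
    List.map_congr_left fun a ha => letterMat_congr (h a.1 (by
      simp only [support, List.coe_toFinset, Set.mem_setOf_eq, List.mem_map]; exact ⟨a, ha, rfl⟩))
  change insProd ε X l x U = insProd ε X l x V
  unfold insProd
  rw [hl, insMat_congr ε X (h _ (Finset.mem_coe.2 (fst_get_mem_support l x)))]

/-- **Double-insertion products are cylinder functions** on the support of the word. [folklore] -/
theorem dependsOn_ins2Prod (l : Chatterjee2019LargeN.Word d) (x y : Fin l.length) :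
    DependsOn (fun U : LGConfig d (SO N) => ins2Prod ε X l x y U) (↑(support l) : Set (ZdEdge d)) := by
  intro U V h
  have hl : l.map (letterMat U) = l.map (letterMat V) :=
    List.map_congr_left fun a ha => letterMat_congr (h a.1 (by
      simp only [support, List.coe_toFinset, Set.mem_setOf_eq, List.mem_map]; exact ⟨a, ha, rfl⟩))
  change ins2Prod ε X l x y U = ins2Prod ε X l x y V
  unfold ins2Prod
  rw [hl, insMat_congr ε X (h _ (Finset.mem_coe.2 (fst_get_mem_support l x))),
    insMat_congr ε X (h _ (Finset.mem_coe.2 (fst_get_mem_support l y))),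
    ins2Mat_congr ε X (h _ (Finset.mem_coe.2 (fst_get_mem_support l x)))]

end Regularity

end SOMasterLoop

end Summit.QuantumFields.GaugeBoot
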